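import Literature.MathematicalPhysics.QuantumFieldTheory.Balaban1983to89.B9SupplySockB9P3ZdUnivWitnessSrc
import Literature.MathematicalPhysics.QuantumFieldTheory.Balaban1983to89.B9SupplySockB9P3ZdAtLin
import Literature.MathematicalPhysics.QuantumFieldTheory.Balaban1983to89.Node00.CarriersB8Sub
import Literature.MathematicalPhysics.QuantumFieldTheory.Balaban1983to89.B8Ineq166Univ

/-!
# `Balaban1983to89.B8IdxB8LawsCoverZero` — [Balaban1985RegularSpaces] (1.6) p.77 + (1.19) p.79 + (1.34) p.82 at truncation zero: AT A LAW MEMBER THE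
# LEVEL-0 CONSTRAINT FAMILY OF THE 0-TRUNCATED TOWER IS ALL OF `Ω₀` — `Λs 0 0 = ℤᵈ` at the `Ω₀ = ℤᵈ` law members — and the consumers'-index (`Node00.IdxB8SubB θ`)
# keyed images of dag-n06-b's truncation-0 A6 WITNESSES for the J-N06→N05 junction binders

statement-level skeleton of published theorems with citation tags; proofs where landed; nothing here is a claim about the
Yang–Mills mass gap

PDF held: `paper:balaban1985-cmp99-regular-spaces-gauge-fixing` ([B8]; journal page = PDF page + 74), pp. 77, 79, 82, 86.

WHY THIS FILE (cell `pub-ymgap`, seat `pub-ymgap-dag-n05-d` g8; count-neutral).  dag-n06-b's A6 witnesses for the `Ω₀ = ℤᵈ` road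
(`B9SupplySockB9P3ZdUnivWitness.binders_inhabited_univ_zero ∕ sockB9P3_at_univ_nonvacuous_zero_of_laws`, p544605; `B9SupplySockB9P3ZdUnivWitnessSrc.binders_inhabited_univ_zero_src`,
p547642) are stated at a member `i : ZdIdx d L` with `i.Ω 0 = ℤᵈ` under the side condition «every bond is a level-0 constraint bond at truncation 0» (`∀ b, b ∈ i.Λb 0 0`),
reduced by `mem_lamB_zero_of_laws` to `i.Λs 0 0 = ℤᵈ` at a member obeying the bond law.  The N05 knits ∕ closers (`BalabanUVNodesN05SubBHKnitUnivT8Srv` p521275,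
`BalabanUVNodesN05SubBHKnitUnivOfThm33` p551339) key their member-local binders on the SUB-INDEX OF RECORD `Node00.IdxB8SubB θ` = the `Ω₀ = ℤᵈ` members obeying the four located
index laws (`Node00.IdxB8Laws`: №7 scale, №8 truncation, №11 cover; `IdxB8LawsB`: №12 bonds).  THIS FILE proves that the laws GIVE the side condition — by the cover law (1.6) at
level 0 every site lies under some tower top, and by the truncation laws (1.19)∕(1.34) descending from `m = k` to `m = 0` the block of a kept top is absorbed into the
diagonal family, so `Λs 0 0 ⊇ ℤᵈ` — and records the witnesses keyed on `IdxB8SubB θ`, in the record's own coefficient algebra `θ.𝔸` (dag-n06-b's HANDOFF t2, «≈150 l.»).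

WHAT IS PROVED (kernel, 0 sorry, theorems only, no new definition).
* §1 `lamS_below_eq_top` (№8 below the diagonal: `Λs m j = Λs k j` for `j < m ≤ k`); `mem_lamS_diag_of_under` (descending induction: a site under a tower top `y ∈ Λs k j`
  at depth `j − m` lies in `Λs m m`); ★ `lamS_zero_zero_eq_univ` (`IdxB8Laws L i`, `L ≥ 1`, `i.Ω 0 = ℤᵈ` ⇒ `i.Λs 0 0 = ℤᵈ`); `mem_lamB_zero_zero_of_lawsB` (+ №12 ⇒ every bond is in
  `i.Λb 0 0`).
* §2 (keyed on `Node00.IdxB8SubB θ`, algebra `θ.𝔸`, `θ.D ≥ 2`): `sockB9P3_zero_nonvacuous_idxB8SubB` — at EVERY member of the sub-index of record the five-line socket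
  `SockB9P3` holds at truncation `0` for SOME positive constants (MEMBER-DEPENDENT: the shape of the `SB9all` binder of p521275 is inhabited member by member at its
  `m = 0` slice — not family-uniformly in the knit's fixed constants); ★ `binders_inhabited_zero_src_idxB8SubB`
  — at EVERY member of the sub-index of record the TEN member-local dictionary binders of p551339 (`DictAt … SrcHolderAt`) at `(M, m) = (1, 0)` together with both blocks of
  [4] Theorem 3.3 are jointly inhabited (dag-n06-b's `binders_inhabited_univ_zero_src` verbatim at `i := j.1.1`); (v1.1) `binders_inhabited_zero_lin_idxB8SubB` — the same
  for the GUARDED letter set of `BalabanUVNodesN05SubBHKnitUnivOfThm33Lin` (`LinBddAt` for `GopAddAt`; dag-n06-b's `B9SupplySockB9P3ZdAtLin.binders_inhabited_univ_zero_lin`).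
HONEST SCOPE.  Lattice combinatorics of the located index laws + two instantiations; the witnesses are dag-n06-b's (trivial massive regime), their scope unchanged: truncation
`m = 0` and block parameter `M = 1` ONLY — the binder families of the knits (all `M`, all `m ≤ k`) are A6-witnessed on that slice and UNCHECKED beyond it ([4] Sect. A +
Thm 3.11 + Thm 3.3, N06's object layer).  Nothing of [4] ∕ [B8] is proved; count-neutral; N05 ∕ N06 NOT discharged; one finite lattice programme; nothing continuum ∕ ℝ⁴ ∕ OS ∕
mass-gap ∕ Clay.  Unit `pub-ymgap-dag-n05-d` (g8), 2026-08-27.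
-/

noncomputable section

namespace Literature.MathematicalPhysics.QuantumFieldTheory.Balaban1983to89.B8IdxB8LawsCoverZero

open Literature.MathematicalPhysics.QuantumFieldTheory.Balaban1983to89.Node00 (IdxB8Laws IdxB8 Stage3Params)
open B8IdxB8LawsB (IdxB8LawsB IdxB8SubB)
open B8LeafModelZd (ZdIdx)
open B8LeafModelZd3 (SockB9P3)
open B8Ineq132 (Under)
open B8Eq131Cubes (flm under_flm)
open B8Eq131Derivation (under_zero_iff)
open B8Ineq166Univ (flm_under_of_under)
open B8Thm4TruncationLocal (mem_blockSites_of_under_one)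
open B9SupplySockB9P3ZdLetters (OpsZd)
open B9SupplySockB9P3ZdAt (DictAt Prop6At InvAt CurvAt LandauAt AvgAt HolderAt GopAddAt SrcAt SrcHolderAt)
open B9SupplySockB9P3ZdUnivWitness (mem_lamB_zero_of_laws sockB9P3_at_univ_nonvacuous_zero_of_laws)
open B9SupplySockB9P3ZdUnivWitnessSrc (binders_inhabited_univ_zero_src)
open B9SupplySockB9P3ZdAtLin (LinBddAt binders_inhabited_univ_zero_lin)
open B7Prop2Explicit (unitaryUnits)

-- `Site` alone could resolve to the torus sites of `Setup.lean`; re-export the `ℤ^d` sites of `B7Prop1Explicit`.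
export B7Prop1Explicit (Site)

variable {d : ℕ}

/-! ## §1 The truncation laws below the diagonal, the descent, and `Λs 0 0 = ℤᵈ` -/

section Laws

variable {L : ℕ} {i : ZdIdx d L}

/-- **№8 BELOW THE DIAGONAL, ITERATED**: for `j < m ≤ k` the level-`j` family of the `m`-truncated tower is the level-`j` family of the full tower ((1.19)∕(1.34): truncation
changes only the top). [cite: Balaban1985RegularSpaces, (1.19) p.79, (1.34) p.82] -/
theorem lamS_below_eq_top (h : IdxB8Laws L i) {m j : ℕ} (hjm : j < m) (hm : m ≤ i.k) : i.Λs m j = i.Λs i.k j := by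
  -- `Λs m j = Λs (m + t) j` for every `m + t ≤ k`
  have key : ∀ t : ℕ, m + t ≤ i.k → i.Λs m j = i.Λs (m + t) j := by
    intro t
    induction t with
    | zero => intro _; rfl
    | succ t ih =>
      intro ht
      rw [ih (by omega), ← add_assoc]
      exact h.trunc_lt (m + t) (by omega) j (by omega)
  have e := key (i.k - m) (by omega)
  rwa [Nat.add_sub_cancel' hm] at e

/-- **THE DESCENT**: a site `w` lying at depth `j − m` under a tower top `y ∈ Λs k j` (`m ≤ j ≤ k`) belongs to the diagonal family `Λs m m` of the `m`-truncated tower —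
by descending induction from `m = k` ((1.34): the `m`-truncation keeps the level-`m` tops and adds the blocks of the level-`(m+1)` tops of the `(m+1)`-truncation).
[cite: Balaban1985RegularSpaces, (1.19) p.79, (1.34) p.82, (1.4)–(1.5) p.77] -/
theorem mem_lamS_diag_of_under (h : IdxB8Laws L i) (hL : 1 ≤ L) :
    ∀ n m : ℕ, m + n = i.k → ∀ j, m ≤ j → j ≤ i.k → ∀ y ∈ i.Λs i.k j, ∀ w, Under L (j - m) y w → w ∈ i.Λs m m := by
  intro n
  induction n with
  | zero =>
    intro m hm j hmj hjk y hy w hw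
    have hjm : j = m := by omega
    subst hjm
    rw [Nat.sub_self, under_zero_iff] at hw
    subst hw
    have hk : j = i.k := by omega
    subst hk
    exact hy
  | succ n ih =>
    intro m hm j hmj hjk y hy w hw
    have hmk : m < i.k := by omega
    rcases Nat.eq_or_lt_of_le hmj with hjm | hjm
    · -- the top itself: `Λs k m = Λs (m+1) m ⊆ Λs m m`
      subst hjm
      rw [Nat.sub_self, under_zero_iff] at hw
      subst hw
      have e : i.Λs (m + 1) m = i.Λs i.k m := lamS_below_eq_top h (Nat.lt_succ_self m) (by omega)
      rw [← e] at hy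
      exact (h.trunc_top m hmk _).2 (Or.inl hy)
    · -- one block down: `w ∈ B(z)` with `z` at depth `j − (m+1)` under `y`, `z ∈ Λs (m+1) (m+1)` by induction
      have hz : Under L (j - (m + 1)) y (flm L 1 w) := by
        have e := flm_under_of_under hL (show 1 ≤ j - m by omega) hw
        rwa [show j - m - 1 = j - (m + 1) by omega] at e
      have hzmem : flm L 1 w ∈ i.Λs (m + 1) (m + 1) := ih (m + 1) (by omega) j (by omega) hjk y hy (flm L 1 w) hz
      exact (h.trunc_top m hmk w).2 (Or.inr ⟨flm L 1 w, hzmem, mem_blockSites_of_under_one (under_flm hL 1 w)⟩)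

/-- ★ **AT AN `Ω₀ = ℤᵈ` LAW MEMBER THE LEVEL-0 CONSTRAINT FAMILY AT TRUNCATION 0 IS ALL OF `ℤᵈ`**: by the cover law (1.6) at level `0` every site lies under some tower top;
by the descent it belongs to `Λs 0 0`. [cite: Balaban1985RegularSpaces, (1.6) p.77, (1.19) p.79, (1.34) p.82] -/
theorem lamS_zero_zero_eq_univ (h : IdxB8Laws L i) (hL : 1 ≤ L) (hΩ : i.Ω 0 = Set.univ) : i.Λs 0 0 = Set.univ := by
  ext w
  simp only [Set.mem_univ, iff_true]
  obtain ⟨j, -, hjk, y, hy, hw⟩ := h.cover 0 (Nat.zero_le _) w (fun x _ => by rw [hΩ]; trivial)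
  exact mem_lamS_diag_of_under h hL i.k 0 (zero_add _) j (Nat.zero_le _) hjk y hy w hw

/-- … hence, with the bond law №12, EVERY bond is a level-0 constraint bond at truncation 0 (dag-n06-b's `mem_lamB_zero_of_laws` with its side condition discharged).
[cite: Balaban1985RegularSpaces, (1.31) p.82, p.86 («𝔅_k»), (1.6) p.77] -/
theorem mem_lamB_zero_zero_of_lawsB (h : IdxB8LawsB L i) (hL : 1 ≤ L) (hΩ : i.Ω 0 = Set.univ) (b : Site d × Fin d) : b ∈ i.Λb 0 0 :=
  mem_lamB_zero_of_laws h hΩ (lamS_zero_zero_eq_univ h.toIdxB8Laws hL hΩ) b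

end Laws

/-! ## §2 dag-n06-b's truncation-0 witnesses keyed on the sub-index of record `Node00.IdxB8SubB θ` -/

section Keyed

variable (θ : Stage3Params)

/-- **THE SHAPE OF THE N05 KNIT's `SB9all` BINDER IS INHABITED AT `m = 0`, MEMBER BY MEMBER, OVER THE SUB-INDEX OF RECORD** (algebra `θ.𝔸`; constants depend on the
member — NOT a family-uniform witness in the knit's fixed constants): dag-n06-b's `sockB9P3_at_univ_nonvacuous_zero_of_laws` at `i := j.1.1`, its side condition
`Λs 0 0 = ℤᵈ` discharged by `lamS_zero_zero_eq_univ`.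
[cite: Balaban1985RegularSpaces, (1.59) p.86, p.77 («we admit Ω_j = T_η»), (1.6) p.77; Balaban1985BackgroundPropagators, Thm 3.3 p.399] -/
theorem sockB9P3_zero_nonvacuous_idxB8SubB (hD : 2 ≤ θ.D) (j : IdxB8SubB θ) {β : ℝ} (hβ0 : 0 ≤ β) (hβ1 : β < 1) {len : Site θ.D → ℝ}
    (hlen : ∀ v : Site θ.D, 0 < len v → 1 ≤ len v) :
    ∃ B₀ B₀β cP : ℝ, 0 < B₀ ∧ 0 ≤ B₀β ∧ 0 < cP ∧ SockB9P3 (𝔸 := θ.𝔸) θ.L B₀ B₀β cP β len j.1.1.η 0 j.1.1.Ω j.1.1.Λs j.1.1.Λb :=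
  have hL1 : 1 ≤ θ.L := le_trans (by norm_num) θ.two_le_L
  sockB9P3_at_univ_nonvacuous_zero_of_laws hD hL1 j.2 j.1.2 (lamS_zero_zero_eq_univ j.2.toIdxB8Laws hL1 j.1.2) hβ0 hβ1 hlen

/-- ★ **THE TEN MEMBER-LOCAL DICTIONARY BINDERS OF `BalabanUVNodesN05SubBHKnitUnivOfThm33` AT `(M, m) = (1, 0)`, WITH BOTH BLOCKS OF [4] THEOREM 3.3, ARE JOINTLY INHABITED AT
EVERY MEMBER OF THE SUB-INDEX OF RECORD** (algebra `θ.𝔸`, any `0 ≤ β < 1`, any length with «non-zero admissible displacement ⇒ ≥ 1»; frame, letters and constants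
member-dependent): dag-n06-b's `binders_inhabited_univ_zero_src` (trivial massive regime + additive extension) at `i := j.1.1`, its side condition discharged by
`mem_lamB_zero_zero_of_lawsB`.  Scope: the `(1, ·, 0)` slice ONLY, one member at a time (the knit's binders range over all `M`, all `m ≤ k`, with ONE frame for all members —
that family-level inhabitation is N06's object layer, NOT witnessed). [cite: Balaban1985BackgroundPropagators, Thm 3.3 p.399, (3.26)–(3.27) p.395, (3.16) p.393; Balaban1985RegularSpaces, Thm 8 + (1.146) p.101, (1.6) p.77] -/
theorem binders_inhabited_zero_src_idxB8SubB (hD : 2 ≤ θ.D) (j : IdxB8SubB θ) {β : ℝ} (hβ0 : 0 ≤ β) (hβ1 : β < 1) {len : Site θ.D → ℝ}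
    (hlen : ∀ v : Site θ.D, 0 < len v → 1 ≤ len v) :
    ∃ (I : Type) (geo : I → B9.Geometry) (bg : I → B9.Backgrounds) (GA : ∀ x, B9.KernelFamily (geo x) (bg x))
      (mem : ℝ → ZdIdx θ.D θ.L → ℕ → I)
      (ιCfg : ∀ (M : ℝ) (i' : ZdIdx θ.D θ.L) (m : ℕ) (U₀ : Site θ.D → Fin θ.D → θ.𝔸ˣ), (∀ x κ, U₀ x κ ∈ unitaryUnits θ.𝔸) → (bg (mem M i' m)).Cfg)
      (ιLoc : ∀ (M : ℝ) (i' : ZdIdx θ.D θ.L) (m : ℕ), (Site θ.D → Fin θ.D → θ.𝔸) → (geo (mem M i' m)).Loc)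
      (ops : ℝ → ZdIdx θ.D θ.L → ℕ → OpsZd θ.D θ.𝔸) (c35 c₆ K₆ a₃ c69 q CH cS cSβ B₀ δ₀ a₀ : ℝ) (Bβ Bε : ℝ → ℝ) (Bεβ : ℝ → ℝ → ℝ),
      0 < K₆ ∧ 0 ≤ c69 ∧ 0 ≤ q ∧ 0 ≤ cS ∧ 0 ≤ cSβ ∧ 0 < B₀ ∧ 0 < c₆ ∧ 0 < a₃ ∧ 0 < a₀ ∧ 0 ≤ CH ∧
      DictAt geo bg GA θ.L mem ιCfg ιLoc ops 1 j.1.1 0 ∧ Prop6At bg θ.L mem ιCfg c35 c₆ K₆ 1 j.1.1 0 ∧ InvAt bg θ.L mem ιCfg ops c35 a₃ 1 j.1.1 0 ∧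
      CurvAt bg θ.L mem ιCfg ops c35 a₃ c69 1 j.1.1 0 ∧ LandauAt bg θ.L mem ιCfg ops c35 a₃ 1 j.1.1 0 ∧ AvgAt θ.L ops q 1 j.1.1 0 ∧
      HolderAt geo bg GA θ.L mem ιCfg ops β len CH 1 j.1.1 0 ∧ GopAddAt θ.L ops 1 j.1.1 0 ∧ SrcAt bg θ.L mem ιCfg ops c35 a₃ cS 1 j.1.1 0 ∧
      SrcHolderAt bg θ.L mem ιCfg ops c35 a₃ β len cSβ 1 j.1.1 0 ∧
      (∀ (α₀ : ℝ) (U₀ : Site θ.D → Fin θ.D → θ.𝔸ˣ) (hU₀ : ∀ x κ, U₀ x κ ∈ unitaryUnits θ.𝔸), 0 < α₀ → 1 * α₀ ≤ a₀ →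
        (bg (mem 1 j.1.1 0)).Reg335 c35 α₀ (ιCfg 1 j.1.1 0 U₀ hU₀) →
        B9.Ineq342_346_347 (GA (mem 1 j.1.1 0)) B₀ δ₀ (ιCfg 1 j.1.1 0 U₀ hU₀) ∧
          B9.Ineq343_345 (GA (mem 1 j.1.1 0)) Bβ Bε Bεβ δ₀ (ιCfg 1 j.1.1 0 U₀ hU₀)) :=
  have hL1 : 1 ≤ θ.L := le_trans (by norm_num) θ.two_le_L
  binders_inhabited_univ_zero_src hD j.1.1 j.1.2 (mem_lamB_zero_zero_of_lawsB j.2 hL1 j.1.2) hβ0 hβ1 hlen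

/-- ★ (v1.1) **THE GUARDED LETTER SET — the ten member-local dictionary binders of `BalabanUVNodesN05SubBHKnitUnivOfThm33Lin` (`LinBddAt` in place of `GopAddAt`) at
`(M, m) = (1, 0)` with both blocks of [4] Theorem 3.3 — IS JOINTLY INHABITED AT EVERY MEMBER OF THE SUB-INDEX OF RECORD** (algebra `θ.𝔸`; frame, letters, constants
member-dependent): dag-n06-b's `B9SupplySockB9P3ZdAtLin.binders_inhabited_univ_zero_lin` (p544605's letters alone) at `i := j.1.1`, side condition from §1.  Scope: the
`(1, ·, 0)` slice ONLY, one member at a time. [cite: Balaban1985BackgroundPropagators, Thm 3.3 p.399, (3.20)–(3.27) pp.394–395, (3.16) p.393; Balaban1985RegularSpaces, Thm 8 + (1.146) p.101, (1.6) p.77] -/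
theorem binders_inhabited_zero_lin_idxB8SubB (hD : 2 ≤ θ.D) (j : IdxB8SubB θ) {β : ℝ} (hβ0 : 0 ≤ β) (hβ1 : β < 1) {len : Site θ.D → ℝ}
    (hlen : ∀ v : Site θ.D, 0 < len v → 1 ≤ len v) :
    ∃ (I : Type) (geo : I → B9.Geometry) (bg : I → B9.Backgrounds) (GA : ∀ x, B9.KernelFamily (geo x) (bg x))
      (mem : ℝ → ZdIdx θ.D θ.L → ℕ → I)
      (ιCfg : ∀ (M : ℝ) (i' : ZdIdx θ.D θ.L) (m : ℕ) (U₀ : Site θ.D → Fin θ.D → θ.𝔸ˣ), (∀ x κ, U₀ x κ ∈ unitaryUnits θ.𝔸) → (bg (mem M i' m)).Cfg)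
      (ιLoc : ∀ (M : ℝ) (i' : ZdIdx θ.D θ.L) (m : ℕ), (Site θ.D → Fin θ.D → θ.𝔸) → (geo (mem M i' m)).Loc)
      (ops : ℝ → ZdIdx θ.D θ.L → ℕ → OpsZd θ.D θ.𝔸) (c35 c₆ K₆ a₃ c69 q CH cS cSβ B₀ δ₀ a₀ : ℝ) (Bβ Bε : ℝ → ℝ) (Bεβ : ℝ → ℝ → ℝ),
      0 < K₆ ∧ 0 ≤ c69 ∧ 0 ≤ q ∧ 0 ≤ cS ∧ 0 ≤ cSβ ∧ 0 < B₀ ∧ 0 < c₆ ∧ 0 < a₃ ∧ 0 < a₀ ∧ 0 ≤ CH ∧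
      DictAt geo bg GA θ.L mem ιCfg ιLoc ops 1 j.1.1 0 ∧ Prop6At bg θ.L mem ιCfg c35 c₆ K₆ 1 j.1.1 0 ∧ InvAt bg θ.L mem ιCfg ops c35 a₃ 1 j.1.1 0 ∧
      CurvAt bg θ.L mem ιCfg ops c35 a₃ c69 1 j.1.1 0 ∧ LandauAt bg θ.L mem ιCfg ops c35 a₃ 1 j.1.1 0 ∧ AvgAt θ.L ops q 1 j.1.1 0 ∧
      HolderAt geo bg GA θ.L mem ιCfg ops β len CH 1 j.1.1 0 ∧ LinBddAt θ.L ops 1 j.1.1 0 ∧ SrcAt bg θ.L mem ιCfg ops c35 a₃ cS 1 j.1.1 0 ∧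
      SrcHolderAt bg θ.L mem ιCfg ops c35 a₃ β len cSβ 1 j.1.1 0 ∧
      (∀ (α₀ : ℝ) (U₀ : Site θ.D → Fin θ.D → θ.𝔸ˣ) (hU₀ : ∀ x κ, U₀ x κ ∈ unitaryUnits θ.𝔸), 0 < α₀ → 1 * α₀ ≤ a₀ →
        (bg (mem 1 j.1.1 0)).Reg335 c35 α₀ (ιCfg 1 j.1.1 0 U₀ hU₀) →
        B9.Ineq342_346_347 (GA (mem 1 j.1.1 0)) B₀ δ₀ (ιCfg 1 j.1.1 0 U₀ hU₀) ∧
          B9.Ineq343_345 (GA (mem 1 j.1.1 0)) Bβ Bε Bεβ δ₀ (ιCfg 1 j.1.1 0 U₀ hU₀)) :=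
  have hL1 : 1 ≤ θ.L := le_trans (by norm_num) θ.two_le_L
  binders_inhabited_univ_zero_lin hD j.1.1 j.1.2 (mem_lamB_zero_zero_of_lawsB j.2 hL1 j.1.2) hβ0 hβ1 hlen

end Keyed

#print axioms lamS_zero_zero_eq_univ
#print axioms binders_inhabited_zero_src_idxB8SubB
#print axioms binders_inhabited_zero_lin_idxB8SubB

end Literature.MathematicalPhysics.QuantumFieldTheory.Balaban1983to89.B8IdxB8LawsCoverZero

end
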